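import Literature.NumberTheory.EllipticCurves.NeronModelAbelianScheme
import Literature.NumberTheory.EllipticCurves.NeronModelLocalCriterion
import Mathlib.RingTheory.Spectrum.Maximal.Defs
import HarnessLib

/-!
# The Néron property may be checked at the local rings of the closed points (BLR 1.2/4)

Infrastructure towards the named fact
`Literature.NumberTheory.EllipticCurves.isNeronModel_of_abelianScheme` (Artin, *Néron Models*,
Cor. (1.4): an abelian scheme over a Dedekind domain is the Néron model of its generic fibre),
continuing `NeronModelAbelianScheme`: the reduction of the fact to the case of a **local** base.

* `exists_map_tensor_of_bijective_atPrime` — spreading out an extension from a local ring of the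
  base to an open neighbourhood: let `R → K` be a ring with a field of fractions, `𝔭` a prime of
  `R`, `R_𝔭 → K` a model of the local ring, `𝒩 → Spec R` locally of finite presentation and
  `𝒳 → Spec R` smooth, quasi-compact and quasi-separated. If `𝒩 ×_R R_𝔭` has the Néron mapping
  property over `R_𝔭`, then every `K`-morphism `u : 𝒳_K → 𝒩_K` extends to an `R`-morphism
  `𝒳 ×_R R[1/s] → 𝒩` for some `s ∉ 𝔭` (extend over `𝒳 ×_R R_𝔭` by the mapping property in tensor
  form, `bijective_map_tensor`; spread out along `𝒳 ×_R R_𝔭 = lim_{s ∉ 𝔭} 𝒳 ×_R R[1/s]`,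
  `LocApprox.exists_whiskerLeft_comp_eq`, EGA IV₃ 8.8.2 / Stacks 01ZC).
* `IsSchematicNeronModel.of_forall_isMaximal` — **Bosch–Lütkebohmert–Raynaud, *Néron Models*,
  §1.2, Prop. 4** (local-to-global direction): a smooth, separated, finite-type `R`-scheme `𝒩`
  such that `𝒩 ×_R R_𝔪` is a Néron model of the `K`-scheme `E` over (every model of) the local
  ring `R_𝔪`, for every maximal ideal `𝔪` of `R`, is a Néron model of `E` over `R` (group-free
  sense `IsSchematicNeronModel`). Proof of the mapping property for a smooth `R`-scheme `𝒳`,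
  which may be taken affine (`bijective_map_of_isAffine`): uniqueness of extensions holds for any
  separated `𝒩` (`map_genericFibre_injective`, schematic density of the generic fibre); for
  existence, extend `u` near each maximal ideal `𝔪` to `𝒳 ×_R R[1/s_𝔪]`, `s_𝔪 ∉ 𝔪`; the `D(s_𝔪)`
  cover `Spec R` (no maximal ideal contains all `s_𝔪`), the extensions agree on overlaps by
  uniqueness, and glue (`Scheme.Cover.glueMorphisms`).
* `IsNeronModel.of_isProper_of_forall_isMaximal`, `isNeronModel_of_abelianScheme_of_isLocalRing`
  — consequently a proper smooth `R`-group scheme is a Néron model of its generic fibre as soon as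
  its base changes to the local rings `R_𝔪` are, and the named fact
  `isNeronModel_of_abelianScheme` for all Dedekind domains follows from its case of a *local*
  Dedekind domain (a discrete valuation ring or a field), indeed from the existence of extensions
  of `K`-morphisms `𝒳_K → 𝒜_K` for abelian schemes `𝒜` over local Dedekind domains and smooth
  affine `𝒳` — which is how Artin's proof of Cor. (1.4) proceeds ("valuative criterion and
  Proposition (1.3)" over the discrete valuation rings `R_𝔭`, cf. the proof of Thm. (1.2),
  p. 228: "Clearly, we may assume `R` local").

No named facts are introduced (D-0026); everything here is proved.

## References

* S. Bosch, W. Lütkebohmert, M. Raynaud, *Néron Models*, Springer 1990, §1.2, Def. 1 and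
  Prop. 4 (Néron models and localization of the base). [BLRNeronModels1990]
* M. Artin, *Néron Models*, in Cornell–Silverman (eds.), *Arithmetic Geometry*, Springer 1986,
  Cor. (1.4) (p. 215) and proof of Thm. (1.2) (p. 228). [Artin1986NeronModels]
* A. Grothendieck, EGA IV₃, Thm. 8.8.2; The Stacks project, Tag 01ZC. [EGAIV3] [StacksProject]
-/

noncomputable section

universe u

namespace Literature.NumberTheory.EllipticCurves

open _root_.AlgebraicGeometry CategoryTheory Limits MonoidalCategory CartesianMonoidalCategory
open Literature.AlgebraicGeometry.Limits
open Literature.AlgebraicGeometry.Motives (SchemeOver specOver)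
open scoped CategoryTheory.Obj

section AtPrimes

variable {R : Type u} [CommRing R] {K : Type u} [Field K] [Algebra R K] [IsFractionRing R K]
  {𝒩 : Over (Spec (.of R))} {E : Over (Spec (.of K))}

/-- Elements of the complement of a prime ideal of `R` are units in the field of fractions `K`.
[folklore] -/
theorem isUnit_algebraMap_of_mem_primeCompl (p : Ideal R) [p.IsPrime] (y : p.primeCompl) :
    IsUnit (algebraMap R K y) :=
  isUnit_iff_ne_zero.mpr ((map_ne_zero_iff _ (IsFractionRing.injective R K)).mpr
    fun h => y.2 (h ▸ p.zero_mem))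

variable (𝒩) in
/-- **Spreading out an extension from a local ring of the base.** Let `R → K` be a ring with a
field of fractions, `𝔭` a prime of `R` and `R_𝔭 → K` a model of the local ring at `𝔭`; let
`𝒩 → Spec R` be locally of finite presentation and `𝒳 → Spec R` smooth, quasi-compact and
quasi-separated. If base change to `K` is bijective on `Hom_{R_𝔭}(𝒳', 𝒩 ×_R R_𝔭)` for every
smooth `R_𝔭`-scheme `𝒳'` (the Néron mapping property of `𝒩 ×_R R_𝔭`), then every `K`-morphism
`u : 𝒳_K → 𝒩_K` is, for some `s ∉ 𝔭`, the generic fibre of an `R`-morphism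
`w : 𝒳 ×_R R[1/s] → 𝒩` (up to the identification `(𝒳 ×_R R[1/s])_K = 𝒳_K`, i.e.
`w_K = (pr₁)_K ≫ u`): `u` extends over `𝒳 ×_R R_𝔭` (`bijective_map_tensor`), and this extension
spreads out along `𝒳 ×_R R_𝔭 = lim_{s ∉ 𝔭} 𝒳 ×_R R[1/s]`, `𝒩` being locally of finite
presentation (`LocApprox.exists_whiskerLeft_comp_eq`; EGA IV₃ 8.8.2, Stacks 01ZC).
[cite: BLRNeronModels1990, §1.2 (Prop. 4)] -/
theorem exists_map_tensor_of_bijective_atPrime (p : Ideal R) [p.IsPrime] (Rp : Type u)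
    [CommRing Rp] [Algebra R Rp] [IsLocalization.AtPrime Rp p] [Algebra Rp K]
    [IsScalarTower R Rp K]
    (HP : ∀ 𝒳' : Over (Spec (.of Rp)), Smooth 𝒳'.hom →
      Function.Bijective fun f' : 𝒳' ⟶ (Over.pullback (specOfAlgebraMap R Rp)).obj 𝒩 =>
        (genericFibre Rp K).map f')
    [LocallyOfFinitePresentation 𝒩.hom] (𝒳 : Over (Spec (.of R))) (h𝒳 : Smooth 𝒳.hom)
    [QuasiCompact 𝒳.hom] [QuasiSeparated 𝒳.hom]
    (u : (genericFibre R K).obj 𝒳 ⟶ (genericFibre R K).obj 𝒩) :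
    ∃ (s : LocApprox.Idx p.primeCompl)
      (w : 𝒳 ⊗ (LocApprox.baseDiagram p.primeCompl).obj s ⟶ 𝒩),
      (genericFibre R K).map w =
        (genericFibre R K).map (fst 𝒳 ((LocApprox.baseDiagram p.primeCompl).obj s)) ≫ u := by
  haveI : Mono (specOfAlgebraMap R Rp) := mono_specOfAlgebraMap_of_isLocalization p.primeCompl Rp
  have hφp : specGenericPoint Rp K ≫ specOfAlgebraMap R Rp = specGenericPoint R K :=
    specGenericPoint_comp_specOfAlgebraMap R K Rp
  -- extend over `𝒳 ×_R R_𝔭` (mapping property of `𝒩 ×_R R_𝔭`, tensor form)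
  have MPp : Function.Bijective fun k : 𝒳 ⊗ specOver R Rp ⟶ 𝒩 => (genericFibre R K).map k :=
    bijective_map_tensor (specOfAlgebraMap R Rp) (specGenericPoint Rp K) hφp 𝒩 𝒳 (HP _ (by
      change Smooth (pullback.snd 𝒳.hom (specOfAlgebraMap R Rp))
      exact MorphismProperty.pullback_snd _ _ h𝒳))
  obtain ⟨v, hv⟩ := MPp.2 ((genericFibre R K).map (fst 𝒳 (specOver R Rp)) ≫ u)
  have hv' : (genericFibre R K).map v = (genericFibre R K).map (fst 𝒳 (specOver R Rp)) ≫ u := hv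
  -- spread `v` out to `𝒳 ⊗ Spec R[1/s]`
  obtain ⟨s, w, hw⟩ :=
    LocApprox.exists_whiskerLeft_comp_eq (S := p.primeCompl) Rp (P := 𝒳) (X := 𝒩) v
  let Ts : Over (Spec (.of R)) := (LocApprox.baseDiagram p.primeCompl).obj s
  let πs : specOver R Rp ⟶ Ts := (LocApprox.baseCone p.primeCompl Rp).π.app s
  have hw' : 𝒳 ◁ πs ≫ w = v := hw
  -- the generic fibre of `w`: the projections `𝒳 ⊗ Spec R_𝔭 → 𝒳`, `𝒳 ⊗ Spec R[1/s] → 𝒳` are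
  -- isomorphisms on generic fibres
  have hsK : IsUnit (algebraMap R K s.val) := isUnit_algebraMap_of_mem_primeCompl p ⟨s.val, s.mem⟩
  letI : Algebra (LocApprox.loc p.primeCompl s) K := (IsLocalization.Away.lift s.val hsK).toAlgebra
  haveI : IsScalarTower R (LocApprox.loc p.primeCompl s) K :=
    IsScalarTower.of_algebraMap_eq fun x => (IsLocalization.Away.lift_eq s.val hsK x).symm
  have hφs : specGenericPoint (LocApprox.loc p.primeCompl s) K ≫
      specOfAlgebraMap R (LocApprox.loc p.primeCompl s) = specGenericPoint R K :=
    specGenericPoint_comp_specOfAlgebraMap R K _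
  haveI : Mono (specOfAlgebraMap R (LocApprox.loc p.primeCompl s)) :=
    mono_specOfAlgebraMap_of_isLocalization (Submonoid.powers s.val) _
  have isos : IsIso ((genericFibre R K).map (fst 𝒳 Ts)) :=
    isIso_pullback_map_fst (specOfAlgebraMap R (LocApprox.loc p.primeCompl s))
      (specGenericPoint _ K) hφs 𝒳
  have isop : IsIso ((genericFibre R K).map (fst 𝒳 (specOver R Rp))) :=
    isIso_pullback_map_fst (specOfAlgebraMap R Rp) (specGenericPoint Rp K) hφp 𝒳
  have isoc : IsIso ((genericFibre R K).map (𝒳 ◁ πs)) := by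
    have h3 : IsIso ((genericFibre R K).map (𝒳 ◁ πs) ≫ (genericFibre R K).map (fst 𝒳 Ts)) := by
      rw [← Functor.map_comp, whiskerLeft_fst]
      exact isop
    exact @IsIso.of_isIso_comp_right _ _ _ _ _ _ _ isos h3
  refine ⟨s, w, ?_⟩
  rw [← cancel_epi ((genericFibre R K).map (𝒳 ◁ πs)), ← Functor.map_comp, hw', hv',
    ← Functor.map_comp_assoc, whiskerLeft_fst]

/-- **The Néron property is local at the closed points of the base** (Bosch–Lütkebohmert–Raynaud,
*Néron Models*, §1.2, Prop. 4, local-to-global direction). Let `R → K` be a ring with a field of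
fractions and `𝒩 → Spec R` smooth, separated and of finite type. If for every maximal ideal `𝔪`
of `R` and every model `R_𝔪 → K` of the local ring at `𝔪`, the base change `𝒩 ×_R R_𝔪` is a Néron
model of the `K`-scheme `E` over `R_𝔪` (group-free sense `IsSchematicNeronModel`), then `𝒩` is a
Néron model of `E` over `R`. Proof of the mapping property for a smooth `R`-scheme `𝒳`, which may
be taken affine (`bijective_map_of_isAffine`): uniqueness holds for any separated `𝒩`
(`map_genericFibre_injective_of_smooth`); given `u : 𝒳_K → 𝒩_K`, for each maximal `𝔪` there are
`s_𝔪 ∉ 𝔪` and an extension `w_𝔪` of `u` over `𝒳 ×_R R[1/s_𝔪]`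
(`exists_map_tensor_of_bijective_atPrime`); the `D(s_𝔪)` cover `Spec R`, the `w_𝔪` agree on the
overlaps of the induced cover of `𝒳` by uniqueness, and glue to the sought extension.
[cite: BLRNeronModels1990, §1.2 (Prop. 4)] -/
theorem IsSchematicNeronModel.of_forall_isMaximal (hsm : Smooth 𝒩.hom) (hsep : IsSeparated 𝒩.hom)
    (hlft : LocallyOfFiniteType 𝒩.hom) (hqc : QuasiCompact 𝒩.hom)
    (H : ∀ (p : Ideal R) [p.IsMaximal] (Rp : Type u) [CommRing Rp] [Algebra R Rp]
      [IsLocalization.AtPrime Rp p] [Algebra Rp K] [IsScalarTower R Rp K],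
      IsSchematicNeronModel Rp K ((Over.pullback (specOfAlgebraMap R Rp)).obj 𝒩) E) :
    IsSchematicNeronModel R K 𝒩 E := by
  classical
  -- the models `Localization.AtPrime 𝔪 → K`, for all maximal `𝔪`
  letI algK : ∀ p : MaximalSpectrum R, Algebra (Localization.AtPrime p.asIdeal) K := fun p =>
    (IsLocalization.lift (M := p.asIdeal.primeCompl)
      (isUnit_algebraMap_of_mem_primeCompl (K := K) p.asIdeal)).toAlgebra
  haveI : ∀ p : MaximalSpectrum R, IsScalarTower R (Localization.AtPrime p.asIdeal) K := fun p =>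
    IsScalarTower.of_algebraMap_eq fun x =>
      (IsLocalization.lift_eq (isUnit_algebraMap_of_mem_primeCompl (K := K) p.asIdeal) x).symm
  have HP : ∀ p : MaximalSpectrum R, IsSchematicNeronModel (Localization.AtPrime p.asIdeal) K
      ((Over.pullback (specOfAlgebraMap R (Localization.AtPrime p.asIdeal))).obj 𝒩) E :=
    fun p => H p.asIdeal _
  -- a maximal ideal (for the generic fibre)
  haveI : Nontrivial R := (algebraMap R K).domain_nontrivial
  obtain ⟨m, hm⟩ := Ideal.exists_maximal R
  let m' : MaximalSpectrum R := ⟨m, hm⟩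
  haveI : Mono (specOfAlgebraMap R (Localization.AtPrime m'.asIdeal)) :=
    mono_specOfAlgebraMap_of_isLocalization m.primeCompl _
  refine
    { smooth := hsm
      isSeparated := hsep
      locallyOfFiniteType := hlft
      quasiCompact := hqc
      nonempty_iso := nonempty_iso_of_pullback_pullback
        (specOfAlgebraMap R (Localization.AtPrime m'.asIdeal)) (specGenericPoint _ K)
        (specGenericPoint_comp_specOfAlgebraMap R K _) 𝒩 E (HP m').nonempty_iso
      mappingProperty := ?_ }
  haveI := hsm
  haveI := hsep
  refine bijective_map_of_isAffine (specGenericPoint R K) 𝒩 ?_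
  intro 𝒳 h𝒳 h𝒳aff
  haveI := h𝒳aff
  haveI : IsAffineHom 𝒳.hom := isAffineHom_of_isAffine 𝒳.hom
  refine ⟨map_genericFibre_injective_of_smooth R K 𝒩 𝒳 h𝒳, ?_⟩
  intro u
  -- near each maximal ideal: an extension of `u` over `𝒳 ×_R R[1/s_𝔪]`, `s_𝔪 ∉ 𝔪`
  choose s w hwK using fun p : MaximalSpectrum R =>
    exists_map_tensor_of_bijective_atPrime 𝒩 p.asIdeal (Localization.AtPrime p.asIdeal)
      (HP p).mappingProperty 𝒳 h𝒳 u
  let Ts : MaximalSpectrum R → Over (Spec (.of R)) := fun p =>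
    (LocApprox.baseDiagram p.asIdeal.primeCompl).obj (s p)
  let Xs : MaximalSpectrum R → Over (Spec (.of R)) := fun p => 𝒳 ⊗ Ts p
  have hXs : ∀ p, Smooth (Xs p).hom := fun p => smooth_tensorObj_hom_of_smooth h𝒳 inferInstance
  -- the `D(s_𝔪)` cover `Spec R`; the induced open cover of `𝒳`
  let av : MaximalSpectrum R → R := fun p => (s p).val
  have hspan : Ideal.span (Set.range av) = ⊤ := by
    by_contra hne
    obtain ⟨n, hn, hle⟩ := Ideal.exists_le_maximal _ hne
    exact (s ⟨n, hn⟩).mem (hle (Ideal.subset_span ⟨⟨n, hn⟩, rfl⟩))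
  let 𝒰 : (Spec (CommRingCat.of R)).OpenCover :=
    (Scheme.affineOpenCoverOfSpanRangeEqTop (R := .of R) av hspan).openCover
  let 𝒱 : 𝒳.left.OpenCover := 𝒰.pullback₁ 𝒳.hom
  have h𝒱 : ∀ p, 𝒱.f p = (fst 𝒳 (Ts p)).left := fun p => rfl
  -- the extensions agree on overlaps (uniqueness of extensions, `map_genericFibre_injective`)
  have key : ∀ p q, pullback.fst (𝒱.f p) (𝒱.f q) ≫ (w p).left =
      pullback.snd (𝒱.f p) (𝒱.f q) ≫ (w q).left := by
    intro p q
    let W : Over (Spec (.of R)) := Over.mk (pullback.fst (𝒱.f p) (𝒱.f q) ≫ (Xs p).hom)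
    have hW : Smooth W.hom := by
      change Smooth (pullback.fst (𝒱.f p) (𝒱.f q) ≫ (Xs p).hom)
      refine MorphismProperty.comp_mem _ _ _ ?_ (hXs p)
      have : IsOpenImmersion (𝒱.f q) := 𝒱.map_prop q
      infer_instance
    let p₁ : W ⟶ Xs p := Over.homMk (pullback.fst (𝒱.f p) (𝒱.f q)) rfl
    have hcond : pullback.fst (𝒱.f p) (𝒱.f q) ≫ (fst 𝒳 (Ts p)).left =
        pullback.snd (𝒱.f p) (𝒱.f q) ≫ (fst 𝒳 (Ts q)).left := by
      rw [← h𝒱 p, ← h𝒱 q]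
      exact pullback.condition
    have hp₂w : pullback.snd (𝒱.f p) (𝒱.f q) ≫ (Xs q).hom = W.hom := by
      change pullback.snd (𝒱.f p) (𝒱.f q) ≫ (fst 𝒳 (Ts q)).left ≫ 𝒳.hom =
        pullback.fst (𝒱.f p) (𝒱.f q) ≫ (fst 𝒳 (Ts p)).left ≫ 𝒳.hom
      rw [← Category.assoc, ← hcond, Category.assoc]
    let p₂ : W ⟶ Xs q := Over.homMk (pullback.snd (𝒱.f p) (𝒱.f q)) hp₂w
    have hp : p₁ ≫ fst 𝒳 (Ts p) = p₂ ≫ fst 𝒳 (Ts q) := by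
      ext : 1
      exact hcond
    have e : p₁ ≫ w p = p₂ ≫ w q := map_genericFibre_injective_of_smooth R K 𝒩 W hW (by
      change (genericFibre R K).map (p₁ ≫ w p) = (genericFibre R K).map (p₂ ≫ w q)
      simp only [Functor.map_comp, hwK]
      rw [← Category.assoc, ← Category.assoc, ← Functor.map_comp, ← Functor.map_comp, hp])
    exact congrArg CommaMorphism.left e
  -- glue
  let gl : 𝒳.left ⟶ 𝒩.left := Scheme.Cover.glueMorphisms 𝒱 (fun p => (w p).left) key
  have hgl : ∀ p, 𝒱.f p ≫ gl = (w p).left := fun p => Scheme.Cover.ι_glueMorphisms 𝒱 _ key p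
  have hover : gl ≫ 𝒩.hom = 𝒳.hom := by
    refine Scheme.Cover.hom_ext 𝒱 _ _ fun p => ?_
    rw [← Category.assoc, hgl]
    change (w p).left ≫ 𝒩.hom = 𝒱.f p ≫ 𝒳.hom
    rw [Over.w (w p)]
    rfl
  refine ⟨Over.homMk gl hover, ?_⟩
  have hcf : fst 𝒳 (Ts m') ≫ Over.homMk gl hover = w m' := by
    ext : 1
    exact hgl m'
  -- the chart at `m` contains the generic fibre: `(𝒳 ×_R R[1/s_m])_K ≅ 𝒳_K`
  have hsK : IsUnit (algebraMap R K (s m').val) :=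
    isUnit_algebraMap_of_mem_primeCompl m ⟨(s m').val, (s m').mem⟩
  letI : Algebra (LocApprox.loc m.primeCompl (s m')) K :=
    (IsLocalization.Away.lift (s m').val hsK).toAlgebra
  haveI : IsScalarTower R (LocApprox.loc m.primeCompl (s m')) K :=
    IsScalarTower.of_algebraMap_eq fun x => (IsLocalization.Away.lift_eq (s m').val hsK x).symm
  haveI : Mono (specOfAlgebraMap R (LocApprox.loc m.primeCompl (s m'))) :=
    mono_specOfAlgebraMap_of_isLocalization (Submonoid.powers (s m').val) _
  haveI : IsIso ((genericFibre R K).map (fst 𝒳 (Ts m'))) :=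
    isIso_pullback_map_fst (specOfAlgebraMap R (LocApprox.loc m.primeCompl (s m')))
      (specGenericPoint _ K) (specGenericPoint_comp_specOfAlgebraMap R K _) 𝒳
  change (genericFibre R K).map (Over.homMk gl hover) = u
  rw [← cancel_epi ((genericFibre R K).map (fst 𝒳 (Ts m'))), ← Functor.map_comp, hcf, hwK m']

end AtPrimes

/-! ### Consequences for proper smooth group schemes and for the fact `isNeronModel_of_abelianScheme` -/

section AbelianScheme

variable {R : Type u} [CommRing R] {K : Type u} [Field K] [Algebra R K] [IsFractionRing R K]

/-- A proper smooth group scheme `𝒜 → Spec R`, `R` a ring with field of fractions `K`, is a Néron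
model of its generic fibre as soon as, for every maximal ideal `𝔪` of `R` and every model
`R_𝔪 → K` of the local ring, the base change `𝒜 ×_R R_𝔪` has the Néron mapping property over
`R_𝔪` for smooth `R_𝔪`-schemes (`IsSchematicNeronModel.of_forall_isMaximal` with `E = 𝒜_K`, the
generic fibre `(𝒜 ×_R R_𝔪)_K ≅ 𝒜_K` by transitivity of base change; then
`IsNeronModel.of_isProper_of_mappingProperty`).
[cite: BLRNeronModels1990, §1.2 (Prop. 4)] -/
theorem IsNeronModel.of_isProper_of_forall_isMaximal (𝒜 : Over (Spec (.of R))) [GrpObj 𝒜]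
    [IsProper 𝒜.hom] [Smooth 𝒜.hom]
    (H : ∀ (p : Ideal R) [p.IsMaximal] (Rp : Type u) [CommRing Rp] [Algebra R Rp]
      [IsLocalization.AtPrime Rp p] [Algebra Rp K] [IsScalarTower R Rp K],
      ∀ 𝒳' : Over (Spec (.of Rp)), Smooth 𝒳'.hom →
        Function.Bijective fun f' : 𝒳' ⟶ (Over.pullback (specOfAlgebraMap R Rp)).obj 𝒜 =>
          (genericFibre Rp K).map f') :
    IsNeronModel R K 𝒜 ((genericFibre R K).obj 𝒜) := by
  refine IsNeronModel.of_isProper_of_mappingProperty 𝒜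
    (IsSchematicNeronModel.of_forall_isMaximal (E := (genericFibre R K).obj 𝒜) ‹_› inferInstance
      inferInstance inferInstance fun p _ Rp _ _ _ _ _ => ?_).mappingProperty
  haveI : Mono (specOfAlgebraMap R Rp) := mono_specOfAlgebraMap_of_isLocalization p.primeCompl Rp
  have hφ : specGenericPoint Rp K ≫ specOfAlgebraMap R Rp = specGenericPoint R K :=
    specGenericPoint_comp_specOfAlgebraMap R K Rp
  exact
    { smooth := by
        change Smooth (pullback.snd 𝒜.hom (specOfAlgebraMap R Rp))
        exact MorphismProperty.pullback_snd _ _ ‹_›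
      isSeparated := by
        change IsSeparated (pullback.snd 𝒜.hom (specOfAlgebraMap R Rp))
        exact MorphismProperty.pullback_snd _ _ inferInstance
      locallyOfFiniteType := by
        change LocallyOfFiniteType (pullback.snd 𝒜.hom (specOfAlgebraMap R Rp))
        exact MorphismProperty.pullback_snd _ _ inferInstance
      quasiCompact := by
        change QuasiCompact (pullback.snd 𝒜.hom (specOfAlgebraMap R Rp))
        exact MorphismProperty.pullback_snd _ _ inferInstance
      nonempty_iso :=
        ⟨pullbackPullbackIso (specOfAlgebraMap R Rp) (specGenericPoint Rp K) 𝒜 ≪≫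
          eqToIso (by rw [hφ])⟩
      mappingProperty := H p Rp }

/-- **The fact `isNeronModel_of_abelianScheme` reduces to local Dedekind domains** (discrete
valuation rings and fields), indeed to the existence of extensions there: if for every *local*
Dedekind domain `R` with fraction field `K`, every abelian scheme `𝒜` over `R` (proper smooth
group scheme with geometrically connected fibres) and every smooth `R`-scheme `𝒳` with affine
total space, every `K`-morphism `𝒳_K → 𝒜_K` extends to an `R`-morphism `𝒳 → 𝒜`, then every
abelian scheme over any Dedekind domain is the Néron model of its generic fibre. This is the
shape of Artin's proof of Cor. (1.4) ("valuative criterion and Proposition (1.3)", over the local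
rings; "clearly, we may assume `R` local", p. 228): the local rings `R_𝔪` of a Dedekind domain at
its maximal ideals are local Dedekind domains with fraction field `K` (Mathlib
`IsLocalization.AtPrime.isDedekindDomain`), `𝒜 ×_R R_𝔪` is an abelian scheme over `R_𝔪`, so it is
the Néron model of its generic fibre by the hypothesis (`IsNeronModel.of_isProper_of_forall_exists`),
and the Néron property of `𝒜` over `R` follows (`IsNeronModel.of_isProper_of_forall_isMaximal`).
[cite: Artin1986NeronModels, Cor. (1.4) (p. 215) and proof of Thm. (1.2) (p. 228)] -/
theorem isNeronModel_of_abelianScheme_of_isLocalRing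
    (H : ∀ (R : Type u) [CommRing R] [IsDedekindDomain R] [IsLocalRing R] (K : Type u) [Field K]
      [Algebra R K] [IsFractionRing R K] (𝒜 : Over (Spec (.of R))) [GrpObj 𝒜] [IsProper 𝒜.hom]
      [Smooth 𝒜.hom] [GeometricallyConnected 𝒜.hom] (𝒳 : Over (Spec (.of R))),
      Smooth 𝒳.hom → IsAffine 𝒳.left →
        ∀ u : (genericFibre R K).obj 𝒳 ⟶ (genericFibre R K).obj 𝒜,
          ∃ f : 𝒳 ⟶ 𝒜, (genericFibre R K).map f = u) :
    isNeronModel_of_abelianScheme.{u} := by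
  intro R _ _ K _ _ _ 𝒜 _ _ _ _
  refine IsNeronModel.of_isProper_of_forall_isMaximal 𝒜 fun p _ Rp _ _ _ _ _ => ?_
  haveI : IsDomain Rp := IsLocalization.isDomain_of_atPrime Rp p
  haveI : IsDedekindDomain Rp := IsLocalization.AtPrime.isDedekindDomain R p Rp
  haveI : IsLocalRing Rp := IsLocalization.AtPrime.isLocalRing Rp p
  haveI : IsFractionRing Rp K :=
    IsFractionRing.isFractionRing_of_isDomain_of_isLocalization p.primeCompl Rp K
  haveI : IsProper ((Over.pullback (specOfAlgebraMap R Rp)).obj 𝒜).hom := by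
    change IsProper (pullback.snd 𝒜.hom (specOfAlgebraMap R Rp))
    infer_instance
  haveI : Smooth ((Over.pullback (specOfAlgebraMap R Rp)).obj 𝒜).hom := by
    change Smooth (pullback.snd 𝒜.hom (specOfAlgebraMap R Rp))
    infer_instance
  haveI : GeometricallyConnected ((Over.pullback (specOfAlgebraMap R Rp)).obj 𝒜).hom := by
    change GeometricallyConnected (pullback.snd 𝒜.hom (specOfAlgebraMap R Rp))
    infer_instance
  exact (IsNeronModel.of_isProper_of_forall_exists ((Over.pullback (specOfAlgebraMap R Rp)).obj 𝒜)
    fun 𝒳 h𝒳 h𝒳a u => H Rp K _ 𝒳 h𝒳 h𝒳a u).mappingProperty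

end AbelianScheme

end Literature.NumberTheory.EllipticCurves

end
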